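import Summits.Ventures.PercRepro.RankLevelSetLevelSixHeavyCellSq27DI2V
import Summits.Ventures.PercRepro.RankLevelSetCoreSixColoopFreeUnion
import Summits.Ventures.PercRepro.RankLevelSetLevelSixCapGlue25
import Summits.Ventures.PercRepro.TriangleCapEightI
import Summits.Ventures.PercRepro.S1TrianglePlusSharp
import Summits.Ventures.PercRepro.S1SeriesLever14
import Summits.Ventures.PercRepro.RankLevelSetCircuitUnionRank
import Summits.Ventures.PercRepro.RankLevelSetLevelSixArithHeavySq23TF12A
import Summits.Ventures.PercRepro.RankLevelSetLevelSixArithHeavySq22TF12A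
import Summits.Ventures.PercRepro.RankLevelSetLevelSixArithHeavySq21TF12A

/-!
# PercRepro — THE 23 ROW, CORANK 12, PART A: THE HONEST CELL AND THE SCALED CELLS AT LEVELS 1, 2 (p8 g11, S3)

`proofs/SUBCLAIM-S3-p8.md` §3y. `(phiK p 6)·#U ≤ #Y` on a coloop-free `e`-free core of rank `p ≥ 23`, corank `12`, on the cell `sq27di2v` with the `H`-term factor `p + 12 − 19` (`ν₁ = 8`, `j = 2`, `j′ = 1`, `|UG| ≤ 23`, `|UH| ≤ 19`, `Kn/Kd = 21206/1000`; `D = C(p + 6, 6)`; caps `s₃ ≤ 26`, `s₄ ≤ 223`, `s₅ ≤ 2315`, `s₆ ≤ 9664`, `s₇ ≤ 24310` at `n₀ = 35`; parts RankLevelSetLevelSixArithHeavySq23TF12A). Axioms: standard.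

`proofs/SUBCLAIM-S3-p8.md` §3y. `(phiK (p + 1) 6 / 2)·#U ≤ #Y` on a coloop-free `e`-free core of rank `p ≥ 22`, corank `12`, on the cell `sq27di2v` with the `H`-term factor `p + 12 − 19` (`ν₁ = 8`, `j = 2`, `j′ = 1`, `|UG| ≤ 23`, `|UH| ≤ 19`, `Kn/Kd = 15335/1000`; `D = C(p + 7, 6)`; caps `s₃ ≤ 26`, `s₄ ≤ 223`, `s₅ ≤ 2327`, `s₆ ≤ 9724`, `s₇ ≤ 24490` at `n₀ = 34`; parts RankLevelSetLevelSixArithHeavySq22TF12A). Axioms: standard.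

`proofs/SUBCLAIM-S3-p8.md` §3y. `(phiK (p + 2) 6 / 4)·#U ≤ #Y` on a coloop-free `e`-free core of rank `p ≥ 21`, corank `12`, on the cell `sq27di2v` with the `H`-term factor `p + 12 − 19` (`ν₁ = 8`, `j = 2`, `j′ = 1`, `|UG| ≤ 23`, `|UH| ≤ 19`, `Kn/Kd = 11137/1000`; `D = C(p + 8, 6)`; caps `s₃ ≤ 26`, `s₄ ≤ 223`, `s₅ ≤ 2339`, `s₆ ≤ 9787`, `s₇ ≤ 24684` at `n₀ = 33`; parts RankLevelSetLevelSixArithHeavySq21TF12A). Axioms: standard.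
-/

open scoped Matroid

namespace PercRepro

namespace ThmN

open Set

variable {α : Type}

-- ===== RankLevelSetLevelSixT23Free12 =====


/-- **THE HONEST COLOOP-FREE CELL `(p ≥ 23, 12)` of the `23` row at corank `12`** (level 0, `phiK p 6`, `D = C(p + 6, 6)`). -/
theorem c025_core_six_t23_free12 (M : Matroid α) [M.Finite] (p : ℕ) (hp : 23 ≤ p) (hcf : ∀ e ∈ M.E, ¬ M.IsColoop e)
    (hR : M.eRank = (p : ℕ∞)) (hn : M.E.ncard = p + 12)
    (hfree : ∀ e ∈ M.E, ∃ A ⊆ M.E \ {e}, e ∉ M.closure A ∧ e ∉ M.closure ((M.E \ {e}) \ A)) :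
    RLS M p 6 := by
  classical
  have hd : M.E.encard = M.eRank + (12 : ℕ) := by
    rw [hR, ← M.ground_finite.cast_ncard_eq, hn]
    push_cast
    ring
  have hL : ∀ e ∈ M.E, ¬ M.IsLoop e := not_isLoop_of_free M hfree
  have hs : ∀ e ∈ M.E, ∀ f ∈ M.E, e ≠ f → M.eRk {e, f} = 2 := by
    intro e he f hf hef
    have h2 : (2 : ℕ∞) ≤ M.eRk {e, f} :=
      two_le_eRk_of_two_le_ncard_of_free M hfree (pair_subset he hf) (by rw [ncard_pair hef])
    have h3 : M.eRk {e, f} ≤ 2 := by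
      have := M.eRk_le_encard {e, f}
      rwa [encard_pair hef] at this
    exact le_antisymm h3 h2
  have hc : ∀ X ⊆ M.E, M.eRk X ≤ ((6 - 2 : ℕ) : ℕ∞) → (X.ncard : ℕ∞) ≤ M.eRk X + cnull 4 :=
    fun X hX hr => nullity_cap_core M hfree 4 (le_refl 4) X hX (by simpa using hr)
  have hc6 : cnull 4 + 1 ≤ 8 := by simp [cnull]
  have hcj : ∀ X ⊆ M.E, M.eRk X ≤ ((6 - 2 - 1 : ℕ) : ℕ∞) → (X.ncard : ℕ∞) ≤ M.eRk X + cnull (3) :=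
    fun X hX hr => nullity_cap_core M hfree 3 (by omega) X hX
      (by rwa [show (6 - 2 - 1 : ℕ) = 3 by omega] at hr)
  have hcj' : ∀ X ⊆ M.E, M.eRk X ≤ ((6 - 1 - 1 - 1 : ℕ) : ℕ∞) → (X.ncard : ℕ∞) ≤ M.eRk X + cnull (3) :=
    fun X hX hr => nullity_cap_core M hfree 3 (by omega) X hX
      (by rwa [show (6 - 1 - 1 - 1 : ℕ) = 3 by omega] at hr)
  have hUG : (Matroid.UG M 6 8).ncard ≤ 23 := by
    have := Matroid.ncard_UG_le_cf (M := M) (q := 6) (ν₁ := 8) (j := 2) (by norm_num) hcf hR hn (by omega) hc hc6 hcj (by norm_num [cnull])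
    simpa using this
  have hUH : (Matroid.UH M 6 8).ncard ≤ 19 := by
    have := Matroid.ncard_UH_le_cf (M := M) (q := 6) (ν₁ := 8) (j' := 1) (by norm_num) hcf hR hn (by omega) hc hc6 hcj' (by norm_num [cnull])
    simpa using this
  have hΦ : phiK p 6 ≤ (2 : ℚ) ^ (p + 6) / (((p + 6).choose 6 : ℕ) : ℚ) := phiK_le_two_pow_div_six p
  rw [RLS_iff]
  exact c025_core_six_heavy_cell_sq27di2v M p 12 8 23 19 0 21206 1000 18 2315 223 26 9664 24310
      ((p + 6).choose 6) (Nat.choose_pos (by omega)) (phiK p 6) hΦ (by norm_num) (by omega)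
      (by norm_num) hUG hUH (by omega) (Or.inl (by norm_num)) (by norm_num) (by norm_num) (by norm_num)
      (s3_cf_of M hfree hcf (d := 11) (by simpa using hd) 35 26 (by norm_num) (by omega) (by decide) (by decide) (by decide))
      ((S1.ncard_fourCircuits_le_gb14 12 M hfree hd 35 (by rw [coloops_eq_empty_of_forall M hcf, Set.sdiff_empty, hn]; omega)).trans (by decide))
      (s5_cf_of M hfree hcf (d := 11) (by rw [hd]; norm_num) 35 1985 2315 (by norm_num) (by omega) (by decide) (by omega))
      (s6_cf_of M hfree hcf (d := 11) (by rw [hd]; norm_num) 35 8008 9664 (by norm_num) (by omega) (by decide) (by omega))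
      (s7_cf_of M hfree hcf (d := 11) (by rw [hd]; norm_num) 35 19448 24310 (by norm_num) (by omega) (by decide) (by omega))
      (Or.inl (tail_six_heavy_sq23TF12_12 p hp)) hR hn hfree (level_six_poly_heavy_sq23TF12_12 p hp)

-- ===== RankLevelSetLevelSixT23S1Cf12 =====


/-- **THE 1-TIMES SCALED COLOOP-FREE CELL `(p ≥ 22, 12)` of the `23` row at corank `12`** (level 1, `phiK (p + 1) 6 / 2`, `D = C(p + 7, 6)`). -/
theorem c025_core_six_t23_scaled1_cf12 (M : Matroid α) [M.Finite] (p : ℕ) (hp : 22 ≤ p) (hcf : ∀ e ∈ M.E, ¬ M.IsColoop e)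
    (hR : M.eRank = (p : ℕ∞)) (hn : M.E.ncard = p + 12)
    (hfree : ∀ e ∈ M.E, ∃ A ⊆ M.E \ {e}, e ∉ M.closure A ∧ e ∉ M.closure ((M.E \ {e}) \ A)) :
    phiK (p + 1) 6 / 2 * (Matroid.topCount M p 6 : ℚ) ≤ (Matroid.midCount M p 6 : ℚ) := by
  classical
  have hd : M.E.encard = M.eRank + (12 : ℕ) := by
    rw [hR, ← M.ground_finite.cast_ncard_eq, hn]
    push_cast
    ring
  have hL : ∀ e ∈ M.E, ¬ M.IsLoop e := not_isLoop_of_free M hfree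
  have hs : ∀ e ∈ M.E, ∀ f ∈ M.E, e ≠ f → M.eRk {e, f} = 2 := by
    intro e he f hf hef
    have h2 : (2 : ℕ∞) ≤ M.eRk {e, f} :=
      two_le_eRk_of_two_le_ncard_of_free M hfree (pair_subset he hf) (by rw [ncard_pair hef])
    have h3 : M.eRk {e, f} ≤ 2 := by
      have := M.eRk_le_encard {e, f}
      rwa [encard_pair hef] at this
    exact le_antisymm h3 h2
  have hc : ∀ X ⊆ M.E, M.eRk X ≤ ((6 - 2 : ℕ) : ℕ∞) → (X.ncard : ℕ∞) ≤ M.eRk X + cnull 4 :=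
    fun X hX hr => nullity_cap_core M hfree 4 (le_refl 4) X hX (by simpa using hr)
  have hc6 : cnull 4 + 1 ≤ 8 := by simp [cnull]
  have hcj : ∀ X ⊆ M.E, M.eRk X ≤ ((6 - 2 - 1 : ℕ) : ℕ∞) → (X.ncard : ℕ∞) ≤ M.eRk X + cnull (3) :=
    fun X hX hr => nullity_cap_core M hfree 3 (by omega) X hX
      (by rwa [show (6 - 2 - 1 : ℕ) = 3 by omega] at hr)
  have hcj' : ∀ X ⊆ M.E, M.eRk X ≤ ((6 - 1 - 1 - 1 : ℕ) : ℕ∞) → (X.ncard : ℕ∞) ≤ M.eRk X + cnull (3) :=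
    fun X hX hr => nullity_cap_core M hfree 3 (by omega) X hX
      (by rwa [show (6 - 1 - 1 - 1 : ℕ) = 3 by omega] at hr)
  have hUG : (Matroid.UG M 6 8).ncard ≤ 23 := by
    have := Matroid.ncard_UG_le_cf (M := M) (q := 6) (ν₁ := 8) (j := 2) (by norm_num) hcf hR hn (by omega) hc hc6 hcj (by norm_num [cnull])
    simpa using this
  have hUH : (Matroid.UH M 6 8).ncard ≤ 19 := by
    have := Matroid.ncard_UH_le_cf (M := M) (q := 6) (ν₁ := 8) (j' := 1) (by norm_num) hcf hR hn (by omega) hc hc6 hcj' (by norm_num [cnull])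
    simpa using this
  have hΦ : phiK (p + 1) 6 / 2 ≤ (2 : ℚ) ^ (p + 6) / (((p + 7).choose 6 : ℕ) : ℚ) := by
    have := phiK_succ_div_two_le p 6
    rwa [show p + 1 + 6 = p + 7 by omega] at this
  exact c025_core_six_heavy_cell_sq27di2v M p 12 8 23 19 0 15335 1000 18 2327 223 26 9724 24490
      ((p + 7).choose 6) (Nat.choose_pos (by omega)) (phiK (p + 1) 6 / 2) hΦ (by norm_num) (by omega)
      (by norm_num) hUG hUH (by omega) (Or.inl (by norm_num)) (by norm_num) (by norm_num) (by norm_num)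
      (s3_cf_of M hfree hcf (d := 11) (by simpa using hd) 34 26 (by norm_num) (by omega) (by decide) (by decide) (by decide))
      ((S1.ncard_fourCircuits_le_gb14 12 M hfree hd 34 (by rw [coloops_eq_empty_of_forall M hcf, Set.sdiff_empty, hn]; omega)).trans (by decide))
      (s5_cf_of M hfree hcf (d := 11) (by rw [hd]; norm_num) 34 1985 2327 (by norm_num) (by omega) (by decide) (by omega))
      (s6_cf_of M hfree hcf (d := 11) (by rw [hd]; norm_num) 34 8008 9724 (by norm_num) (by omega) (by decide) (by omega))
      (s7_cf_of M hfree hcf (d := 11) (by rw [hd]; norm_num) 34 19448 24490 (by norm_num) (by omega) (by decide) (by omega))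
      (Or.inl (tail_six_heavy_sq22TF12_12 p hp)) hR hn hfree (level_six_poly_heavy_sq22TF12_12 p hp)

-- ===== RankLevelSetLevelSixT23S2Cf12 =====


/-- **THE 2-TIMES SCALED COLOOP-FREE CELL `(p ≥ 21, 12)` of the `23` row at corank `12`** (level 2, `phiK (p + 2) 6 / 4`, `D = C(p + 8, 6)`). -/
theorem c025_core_six_t23_scaled2_cf12 (M : Matroid α) [M.Finite] (p : ℕ) (hp : 21 ≤ p) (hcf : ∀ e ∈ M.E, ¬ M.IsColoop e)
    (hR : M.eRank = (p : ℕ∞)) (hn : M.E.ncard = p + 12)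
    (hfree : ∀ e ∈ M.E, ∃ A ⊆ M.E \ {e}, e ∉ M.closure A ∧ e ∉ M.closure ((M.E \ {e}) \ A)) :
    phiK (p + 2) 6 / 4 * (Matroid.topCount M p 6 : ℚ) ≤ (Matroid.midCount M p 6 : ℚ) := by
  classical
  have hd : M.E.encard = M.eRank + (12 : ℕ) := by
    rw [hR, ← M.ground_finite.cast_ncard_eq, hn]
    push_cast
    ring
  have hL : ∀ e ∈ M.E, ¬ M.IsLoop e := not_isLoop_of_free M hfree
  have hs : ∀ e ∈ M.E, ∀ f ∈ M.E, e ≠ f → M.eRk {e, f} = 2 := by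
    intro e he f hf hef
    have h2 : (2 : ℕ∞) ≤ M.eRk {e, f} :=
      two_le_eRk_of_two_le_ncard_of_free M hfree (pair_subset he hf) (by rw [ncard_pair hef])
    have h3 : M.eRk {e, f} ≤ 2 := by
      have := M.eRk_le_encard {e, f}
      rwa [encard_pair hef] at this
    exact le_antisymm h3 h2
  have hc : ∀ X ⊆ M.E, M.eRk X ≤ ((6 - 2 : ℕ) : ℕ∞) → (X.ncard : ℕ∞) ≤ M.eRk X + cnull 4 :=
    fun X hX hr => nullity_cap_core M hfree 4 (le_refl 4) X hX (by simpa using hr)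
  have hc6 : cnull 4 + 1 ≤ 8 := by simp [cnull]
  have hcj : ∀ X ⊆ M.E, M.eRk X ≤ ((6 - 2 - 1 : ℕ) : ℕ∞) → (X.ncard : ℕ∞) ≤ M.eRk X + cnull (3) :=
    fun X hX hr => nullity_cap_core M hfree 3 (by omega) X hX
      (by rwa [show (6 - 2 - 1 : ℕ) = 3 by omega] at hr)
  have hcj' : ∀ X ⊆ M.E, M.eRk X ≤ ((6 - 1 - 1 - 1 : ℕ) : ℕ∞) → (X.ncard : ℕ∞) ≤ M.eRk X + cnull (3) :=
    fun X hX hr => nullity_cap_core M hfree 3 (by omega) X hX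
      (by rwa [show (6 - 1 - 1 - 1 : ℕ) = 3 by omega] at hr)
  have hUG : (Matroid.UG M 6 8).ncard ≤ 23 := by
    have := Matroid.ncard_UG_le_cf (M := M) (q := 6) (ν₁ := 8) (j := 2) (by norm_num) hcf hR hn (by omega) hc hc6 hcj (by norm_num [cnull])
    simpa using this
  have hUH : (Matroid.UH M 6 8).ncard ≤ 19 := by
    have := Matroid.ncard_UH_le_cf (M := M) (q := 6) (ν₁ := 8) (j' := 1) (by norm_num) hcf hR hn (by omega) hc hc6 hcj' (by norm_num [cnull])
    simpa using this
  have hΦ : phiK (p + 2) 6 / 4 ≤ (2 : ℚ) ^ (p + 6) / (((p + 8).choose 6 : ℕ) : ℚ) := by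
    have h := phiK_le_two_pow_div_six (p + 2)
    rw [show p + 2 + 6 = p + 8 by omega] at h
    have h8 : (2 : ℚ) ^ (p + 8) = 2 ^ (p + 6) * 4 := by rw [show p + 8 = p + 6 + 2 by omega, pow_add]; norm_num
    rw [h8] at h
    calc phiK (p + 2) 6 / 4 ≤ (2 : ℚ) ^ (p + 6) * 4 / (((p + 8).choose 6 : ℕ) : ℚ) / 4 := by gcongr
      _ = (2 : ℚ) ^ (p + 6) / (((p + 8).choose 6 : ℕ) : ℚ) := by ring
  exact c025_core_six_heavy_cell_sq27di2v M p 12 8 23 19 0 11137 1000 18 2339 223 26 9787 24684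
      ((p + 8).choose 6) (Nat.choose_pos (by omega)) (phiK (p + 2) 6 / 4) hΦ (by norm_num) (by omega)
      (by norm_num) hUG hUH (by omega) (Or.inl (by norm_num)) (by norm_num) (by norm_num) (by norm_num)
      (s3_cf_of M hfree hcf (d := 11) (by simpa using hd) 33 26 (by norm_num) (by omega) (by decide) (by decide) (by decide))
      ((S1.ncard_fourCircuits_le_gb14 12 M hfree hd 33 (by rw [coloops_eq_empty_of_forall M hcf, Set.sdiff_empty, hn]; omega)).trans (by decide))
      (s5_cf_of M hfree hcf (d := 11) (by rw [hd]; norm_num) 33 1985 2339 (by norm_num) (by omega) (by decide) (by omega))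
      (s6_cf_of M hfree hcf (d := 11) (by rw [hd]; norm_num) 33 8008 9787 (by norm_num) (by omega) (by decide) (by omega))
      (s7_cf_of M hfree hcf (d := 11) (by rw [hd]; norm_num) 33 19448 24684 (by norm_num) (by omega) (by decide) (by omega))
      (Or.inl (tail_six_heavy_sq21TF12_12 p hp)) hR hn hfree (level_six_poly_heavy_sq21TF12_12 p hp)

end ThmN

end PercRepro
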